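/-
PORT (pub-hodgecm2, COR-CM cell) of the stage-1 package file `HodgeCMPerL/HodgeCM/Assembly/CorCM.lean`
(pub-hodgecm HOME/lean, bytes of record md5 a28b2540d3f1, 91 lines). Declarations VERBATIM; edits: imports rewritten to tree
modules, namespace token `HodgeCM` ↦ `Summit.HodgeConjecture.CorCM`, package `conjRingHomK` ↦ tree `Literature.NumberTheory.Automorphic.cmConjRingHom`
(definitionally equal bodies), linter fixes. Generator: pub-hodgecm2-p1 `work/port/build_kit.py`.
-/
/-
Copyright: pub-hodgecm formalisation cell (harness21, 2026). New file (not vendored).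
-/
import Summits.HodgeConjecture.CorCM.StubTree.Reduction

/-!
# Assembly: PerL, the period theorem over F, W^{RK4} and COR-CM (pure-logic wiring, fully proved)

The implications of the dependency table of the follow-ups doc §B.1, PROVED as pure logic over the exact
statements (`Summit.HodgeConjecture.CorCM.Geometry.Statements`), and the end-to-end theorems, whose hypotheses are the model facts
`M : U.ModelAxioms` (28 cited standard facts, `Summit.HodgeConjecture.CorCM.Geometry.Facts`) and — since gen 6, when the package
dropped its last placeholder stubs — exactly the OPEN INPUTS each needs (`Summit.HodgeConjecture.CorCM.StubTree.Inputs`):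
`COR_CM : ModelAxioms → RealisationExistsFace → PohlmannSpan → Qw8Sufficiency → HC_CM`,
`perL : ModelAxioms → RealisationExistsPerL → PerL`.  `#print axioms` of every theorem of this file is
`[propext, Classical.choice, Quot.sound]` (AXIOMS.md).

```
PerL44 ──► PerL                         (perL_of_perL44; Landherr)
PeriodThmF + SurfaceCriterion ──► W_RK4 (w_rk4_of; Landherr, dim P_Γ = 2, rfwf Lemma 2.1)
W_RK4 + FaceReduction + Lemma81 ──► HC_CM = COR-CM   (hc_cm_of)
```
-/

noncomputable section

namespace Summit.HodgeConjecture.CorCM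

namespace Assembly

open Universe StubTree

variable (U : Universe)

/-- `W_per^L` from Thm 4.4: pick any hermitian space (Landherr). -/
theorem perL_of_perL44 (hL : LandherrExists) (h44 : U.PerL44) : U.PerL := by
  intro K L j hN hK hdeg φ hφ ι₁ hι t ht
  obtain ⟨V⟩ := hL L ι₁
  exact ⟨V, h44 K L j hN hK hdeg φ hφ ι₁ hι t ht V⟩

/-- **rfwf Thm 1.3 from Thm 4.1 + Prop 2.2** ("By Theorem 4.1 the hypothesis of Proposition 2.2 holds (with
`S = P_Γ`); Proposition 2.2 gives the conclusion"). -/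
theorem w_rk4_of (h41 : U.PeriodThmF) (h22 : U.SurfaceCriterion) (hL : LandherrExists)
    (hdim : U.PmsDimTwo) (hadm : AdmissibleExists) : U.W_RK4 := by
  intro F hG h6 f
  obtain ⟨ι₁, hι⟩ := hadm F h6 f
  obtain ⟨V⟩ := hL F ι₁
  obtain ⟨Γ, Fm, α, hα, hper⟩ := h41 F hG h6 f ι₁ hι V
  exact h22 F hG f ι₁ hι (U.pms F ι₁ V Γ) (hdim F ι₁ V Γ) Fm α hα hper

/-- **COR-CM from `W^{RK4}` and the two reductions** (rows (ii)–(v) of the table). -/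
theorem hc_cm_of (h1 : U.W_RK4) (h2 : U.FaceReduction) (h3 : U.Lemma81) : U.HC_CM :=
  h3 (fun F hG h6 n Θ => h2 F hG h6 (h1 F hG h6) n Θ)

end Assembly

end Summit.HodgeConjecture.CorCM

end
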